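import Literature.NumberTheory.Transcendental.SemistableTorsion
import Literature.NumberTheory.Transcendental.TorsionOrbit
import Mathlib.Order.ModularLattice
import HarnessLib

/-!
# Quotients of `M_κ` by connected algebraic subgroups are again of type `M_κ'` (transport)

Topic: `Literature/NumberTheory/Transcendental`. Plan item W4 (closing, part 8) of the unit
`provefact-Literature.NumberTheory.Transcendental.H-b596640137`. The inductive step of the
Semistability Theorem over a BORDERLINE subgroup `K₀ = H_{(A₀,C₀,Ξ₀)}` of `M_κ = 𝔾ₘ^β × P_κ`
(Baker–Wüstholz, *Logarithmic Forms and Diophantine Geometry*, §6.8, p. 115: passage to the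
quotient `G → G^*` of minimal index) needs the quotient `M_κ/K₀` as a standard model `M_κ'`
again, exactly as `SemistableQuotients.QuotData` presents `G/H` for `G = 𝔾ₐ × 𝔾ₘ^ι × (E♮)^κ`:
unimodular integer bases `q⁽ʲ⁾` of `A₀`, `c⁽ᵇ⁾` of `C₀`, a `ℚ̄`-basis `ξ⁽ᵉ⁾` of `Ξ₀`, and the
matrix `κ'` with `ξ⁽ᵉ⁾ ∘ κ = ∑_b κ'_{eb} c⁽ᵇ⁾` (compatibility). Everything is PROVED:

* `Std.QuotData`, `nonempty_quotData`; the quotient map `Φ` (`ker Φ = Lie K₀`, onto,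
  `dim Φ⁻¹(X) = dim X + dim Lie K₀`, defined over `ℚ̄`);
* `pull` (subgroups of `M_κ'` ↦ subgroups of `M_κ` containing `K₀`), `comap_tangent`;
* `Φ_mem_AlgTors` (algebraic points with torsion abelian part are preserved),
  `exists_ker_of_Φ_mem_ker` (`Φ w ∈ ker' ⇒ w ∈ ker + Lie K₀`, unimodularity);
* `SubgroupData.mem_tangent_of_forall_exists` — discreteness of `ker(exp_{M_κ/K₀})`:
  `(∀ m ≥ 1, w ∈ m·(ker + Lie K₀)) ⇒ w ∈ Lie K₀`;
* `QuotData.transport` — for a semistable `ℚ̄`-rational proper `𝔟` and a borderline `K₀ ≠ M_κ`,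
  the image `Φ(𝔟)` is `ℚ̄`-rational, proper and SEMISTABLE in `M_κ'` (modular law and the mediant
  inequality `τ(𝔨) ≥ τ(𝔨₀) = τ(0)`), and `dim M_κ' = dim M_κ - dim K₀`.

## References

* A. Baker, G. Wüstholz, *Logarithmic Forms and Diophantine Geometry*, CUP 2007, §6.7, §6.8 (p. 115).
-/

noncomputable section

open Module Submodule Complex
open scoped PeriodPair

namespace Literature.NumberTheory.Transcendental

namespace GaGmE

namespace Std

open LiePresentation

variable {β γ δ : Type} [Fintype β] [Fintype γ] [Fintype δ] {κM : δ → γ → Kbar}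

/-! ### Discreteness of `ker(exp_{M_κ/K₀})` -/

/-- **Discreteness of `ker(exp_{M_κ/K₀})`.** If `v ∈ m · (ker(exp_{M_κ}) + Lie K₀)` for every
`m ≥ 1`, then `v ∈ Lie K₀`: the characters in `A` and the homomorphisms in `C` take values in the
discrete groups `2πiℤ`, `Λ` on `ker`, which have no non-zero divisible elements, and the additive
characters in `Ξ` vanish on the relevant periods by the compatibility `ξ ∘ κ ∈ span C`.
[folklore] -/
theorem SubgroupData.mem_tangent_of_forall_exists {L : PeriodPair} (D : SubgroupData β γ δ κM)
    (v : β ⊕ (γ ⊕ δ) → ℂ)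
    (hv : ∀ m : ℕ, 0 < m → ∃ k ∈ ker L κM, ∃ h ∈ D.tangent, v = (m : ℂ) • (k + h)) :
    v ∈ D.tangent := by
  classical
  rw [SubgroupData.mem_tangent_iff]
  -- the `z`-forms vanish on `v`
  have hC : ∀ c ∈ D.C, ∑ k, (c k : ℂ) * v (iz k) = 0 := by
    intro c hc
    obtain ⟨d, hd, n, hn⟩ := exists_common_den c
    set S : ℂ := ∑ k, (c k : ℂ) * v (iz k) with hS
    have hm : ∀ m : ℕ, 0 < m → ∃ P' Q' : ℤ, (d : ℂ) * S = (m : ℂ) * (P' * L.ω₁ + Q' * L.ω₂) := by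
      intro m hm
      obtain ⟨kv, hkv, h, hh, hvm⟩ := hv m hm
      obtain ⟨-, a, b, hab, -⟩ := hkv
      have hh' := ((SubgroupData.mem_tangent_iff D h).mp hh).2.1 c hc
      refine ⟨∑ k, n k * a k, ∑ k, n k * b k, ?_⟩
      have e1 : (d : ℂ) * S = (m : ℂ) * (∑ k, ((d : ℚ) * c k : ℚ) * kv (iz k)) +
          (m : ℂ) * (d : ℂ) * ∑ k, (c k : ℂ) * h (iz k) := by
        rw [hS, hvm]
        simp only [Pi.smul_apply, Pi.add_apply, smul_eq_mul, Finset.mul_sum]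
        rw [← Finset.sum_add_distrib]
        refine Finset.sum_congr rfl fun k _ => ?_
        push_cast; ring
      rw [e1, hh', mul_zero, add_zero]
      congr 1
      push_cast
      rw [Finset.sum_mul, Finset.sum_mul, ← Finset.sum_add_distrib]
      refine Finset.sum_congr rfl fun k _ => ?_
      have hn' : (d : ℂ) * (c k : ℂ) = (n k : ℂ) := by
        have := congrArg (fun r : ℚ => (r : ℂ)) (hn k)
        push_cast at this
        exact this
      rw [hn', hab k]
      ring
    obtain ⟨P₁, Q₁, e₁⟩ := hm 1 one_pos
    rw [Nat.cast_one, one_mul] at e₁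
    have hPQ : P₁ = 0 ∧ Q₁ = 0 := by
      refine coords_eq_zero_of_forall (L := L) fun m hm' => ?_
      obtain ⟨P', Q', e⟩ := hm m hm'
      exact ⟨P', Q', by rw [← e₁, e]⟩
    obtain ⟨rfl, rfl⟩ := hPQ
    have : (d : ℂ) * S = 0 := by rw [e₁]; simp
    exact (mul_eq_zero.mp this).resolve_left (by exact_mod_cast hd.ne')
  refine ⟨fun q hq => ?_, hC, fun ξ hξ => ?_⟩
  · -- the `y`-forms: values in `2πi ℤ`
    obtain ⟨d, hd, n, hn⟩ := exists_common_den q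
    set S : ℂ := ∑ i, (q i : ℂ) * v (iy i) with hS
    have hm : ∀ m : ℕ, 0 < m → ∃ N : ℤ, (d : ℂ) * S = (m : ℂ) * (N * (2 * Real.pi * I)) := by
      intro m hm
      obtain ⟨kv, hkv, h, hh, hvm⟩ := hv m hm
      obtain ⟨hky, -⟩ := hkv
      choose p hp using hky
      have hh' := ((SubgroupData.mem_tangent_iff D h).mp hh).1 q hq
      refine ⟨∑ i, n i * p i, ?_⟩
      have e1 : (d : ℂ) * S = (m : ℂ) * (∑ i, ((d : ℚ) * q i : ℚ) * kv (iy i)) +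
          (m : ℂ) * (d : ℂ) * ∑ i, (q i : ℂ) * h (iy i) := by
        rw [hS, hvm]
        simp only [Pi.smul_apply, Pi.add_apply, smul_eq_mul, Finset.mul_sum]
        rw [← Finset.sum_add_distrib]
        refine Finset.sum_congr rfl fun i _ => ?_
        push_cast; ring
      rw [e1, hh', mul_zero, add_zero]
      congr 1
      push_cast
      rw [Finset.sum_mul]
      refine Finset.sum_congr rfl fun i _ => ?_
      have hn' : (d : ℂ) * (q i : ℂ) = (n i : ℂ) := by
        have := congrArg (fun r : ℚ => (r : ℂ)) (hn i)
        push_cast at this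
        exact this
      rw [hn', hp i]
      ring
    obtain ⟨N₁, e₁⟩ := hm 1 one_pos
    rw [Nat.cast_one, one_mul] at e₁
    have hN₁ : N₁ = 0 := by
      refine int_eq_zero_of_forall_dvd fun m hm' => ?_
      obtain ⟨N, e⟩ := hm m hm'
      rw [e₁] at e
      have h2 : (2 * Real.pi * I : ℂ) ≠ 0 := by simp [Real.pi_ne_zero, I_ne_zero]
      have : (N₁ : ℂ) = (m : ℂ) * N := by
        have := mul_right_cancel₀ h2 (by rw [e]; ring : (N₁ : ℂ) * (2 * Real.pi * I) =
          ((m : ℂ) * N) * (2 * Real.pi * I))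
        exact this
      exact ⟨N, by exact_mod_cast this⟩
    subst hN₁
    have : (d : ℂ) * S = 0 := by rw [e₁]; simp
    exact (mul_eq_zero.mp this).resolve_left (by exact_mod_cast hd.ne')
  · -- the `s`-forms: use `m = 1` and the compatibility
    obtain ⟨kv, hkv, h, hh, hv1⟩ := hv 1 one_pos
    rw [Nat.cast_one, one_smul] at hv1
    obtain ⟨-, a, b, hab, hks⟩ := hkv
    obtain ⟨-, hhC, hhΞ⟩ := (SubgroupData.mem_tangent_iff D h).mp hh
    -- integer relations: `∑ cₖ aₖ = 0 = ∑ cₖ bₖ` for `c ∈ C`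
    have hrel : ∀ c ∈ D.C, (∑ k, c k * a k : ℚ) = 0 ∧ (∑ k, c k * b k : ℚ) = 0 := by
      intro c hc
      have h1 := hC c hc
      have h2 := hhC c hc
      have h3 : ∑ k, (c k : ℂ) * kv (iz k) = 0 := by
        have : ∑ k, (c k : ℂ) * v (iz k) =
            ∑ k, (c k : ℂ) * kv (iz k) + ∑ k, (c k : ℂ) * h (iz k) := by
          rw [← Finset.sum_add_distrib]
          refine Finset.sum_congr rfl fun k _ => ?_
          rw [hv1]; simp only [Pi.add_apply]; ring
        rw [h1, h2, add_zero] at this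
        exact this.symm
      have e : ((((∑ k, c k * a k : ℚ) : ℝ)) : ℂ) * L.ω₁ + (((∑ k, c k * b k : ℚ) : ℝ) : ℂ) * L.ω₂
          = ((0 : ℝ) : ℂ) * L.ω₁ + ((0 : ℝ) : ℂ) * L.ω₂ := by
        have lhs : ((((∑ k, c k * a k : ℚ) : ℝ)) : ℂ) * L.ω₁ +
            (((∑ k, c k * b k : ℚ) : ℝ) : ℂ) * L.ω₂ = ∑ k, (c k : ℂ) * kv (iz k) := by
          push_cast
          rw [Finset.sum_mul, Finset.sum_mul, ← Finset.sum_add_distrib]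
          refine Finset.sum_congr rfl fun k _ => ?_
          rw [hab k]; ring
        rw [lhs, h3]
        simp
      obtain ⟨e1, e2⟩ := L.real_coords_unique e
      exact ⟨by exact_mod_cast e1, by exact_mod_cast e2⟩
    -- `ξ ∘ κ` kills the quasi-periods of `kv`
    have hkill : ∀ lam ∈ Submodule.span Kbar
        ((fun c : γ → ℚ => fun k => (c k : Kbar)) '' (D.C : Set (γ → ℚ))),
        ∑ k, ((lam k : Kbar) : ℂ) * (a k * L.η₁ + b k * L.η₂) = 0 := by
      intro lam hlam
      induction hlam using Submodule.span_induction with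
      | mem x hx =>
        obtain ⟨c, hc, rfl⟩ := hx
        obtain ⟨r1, r2⟩ := hrel c hc
        dsimp only
        have : ∑ k, (((c k : ℚ) : Kbar) : ℂ) * (a k * L.η₁ + b k * L.η₂) =
            ((∑ k, c k * a k : ℚ) : ℂ) * L.η₁ + ((∑ k, c k * b k : ℚ) : ℂ) * L.η₂ := by
          push_cast
          rw [Finset.sum_mul, Finset.sum_mul, ← Finset.sum_add_distrib]
          exact Finset.sum_congr rfl fun k _ => by ring
        rw [this, r1, r2]
        simp
      | zero => simp
      | add x y _ _ hx hy =>
        simp only [Pi.add_apply]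
        push_cast
        simp only [add_mul, Finset.sum_add_distrib, hx, hy, add_zero]
      | smul r x _ hx =>
        simp only [Pi.smul_apply, smul_eq_mul]
        push_cast
        simp only [mul_assoc, ← Finset.mul_sum, hx, mul_zero]
    have hξκ : ∑ k, ((∑ e, ξ e * κM e k : Kbar) : ℂ) * (a k * L.η₁ + b k * L.η₂) = 0 :=
      hkill _ (D.compat ξ hξ)
    have hpair_k : ∑ e, (ξ e : ℂ) * kv (is e) = 0 := by
      rw [← hξκ]
      simp only [hks]
      push_cast
      simp only [Finset.mul_sum, Finset.sum_mul]
      rw [Finset.sum_comm]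
      exact Finset.sum_congr rfl fun k _ => Finset.sum_congr rfl fun e _ => by ring
    have : ∑ e, (ξ e : ℂ) * v (is e) = ∑ e, (ξ e : ℂ) * kv (is e) + ∑ e, (ξ e : ℂ) * h (is e) := by
      rw [hv1, ← Finset.sum_add_distrib]
      refine Finset.sum_congr rfl fun e _ => ?_
      simp only [Pi.add_apply]; ring
    rw [this, hpair_k, hhΞ ξ hξ, add_zero]

/-! ### Coordinates on `M_κ/K₀` adapted to `K₀` -/

/-- **Coordinates of `Lie(M_κ/K₀)` adapted to `K₀ = H_{(A₀, C₀, Ξ₀)}`**: unimodular integer bases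
`q⁽ʲ⁾` of the characters `A₀` and `c⁽ᵇ⁾` of the homomorphisms `C₀`, a `ℚ̄`-basis `ξ⁽ᵉ⁾` of `Ξ₀`,
and the matrix `κ'` with `ξ⁽ᵉ⁾ ∘ κ = ∑_b κ'_{eb} c⁽ᵇ⁾` (compatibility). The quotient `M_κ/K₀` is
then `M_κ'` with Lie coordinates `y'_j = q⁽ʲ⁾ · y`, `z'_b = c⁽ᵇ⁾ · z`, `s'_e = ξ⁽ᵉ⁾ · s`.
[folklore] -/
structure QuotData (D₀ : SubgroupData β γ δ κM) where
  /-- number of `𝔾ₘ`-coordinates of `M_κ/K₀` -/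
  nA : ℕ
  /-- the integer characters `q⁽ʲ⁾` -/
  qv : Fin nA → β → ℤ
  qv_mem : ∀ j, (fun i => (qv j i : ℚ)) ∈ D₀.A
  qv_span : ∀ q ∈ D₀.A, q ∈ Submodule.span ℚ (Set.range fun j i => (qv j i : ℚ))
  qv_unimod : ∀ t : Fin nA → ℤ, ∃ p : β → ℤ, ∀ j, ∑ i, qv j i * p i = t j
  /-- number of `E`-coordinates of `M_κ/K₀` -/
  nC : ℕ
  /-- the integer homomorphisms `c⁽ᵇ⁾` -/
  cv : Fin nC → γ → ℤ
  cv_mem : ∀ b, (fun k => (cv b k : ℚ)) ∈ D₀.C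
  cv_span : ∀ c ∈ D₀.C, c ∈ Submodule.span ℚ (Set.range fun b k => (cv b k : ℚ))
  cv_unimod : ∀ t : Fin nC → ℤ, ∃ p : γ → ℤ, ∀ b, ∑ k, cv b k * p k = t b
  /-- number of vector-group coordinates of `M_κ/K₀` -/
  nΞ : ℕ
  /-- the additive characters `ξ⁽ᵉ⁾` -/
  ξv : Fin nΞ → δ → Kbar
  ξv_mem : ∀ e, ξv e ∈ D₀.Ξ
  ξv_span : ∀ ξ ∈ D₀.Ξ, ξ ∈ Submodule.span Kbar (Set.range ξv)
  ξv_indep : LinearIndependent Kbar ξv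
  /-- the push-out matrix `κ'` of the quotient -/
  κM' : Fin nΞ → Fin nC → Kbar
  κM'_spec : ∀ e k, ∑ e', ξv e e' * κM e' k = ∑ b, κM' e b * (cv b k : Kbar)

/-- Adapted coordinates exist. [folklore] -/
theorem nonempty_quotData (D₀ : SubgroupData β γ δ κM) : Nonempty (QuotData D₀) := by
  classical
  obtain ⟨nA, qv, qv_mem, qv_span, qv_unimod⟩ := exists_unimodular_basis D₀.A
  obtain ⟨nC, cv, cv_mem, cv_span, cv_unimod⟩ := exists_unimodular_basis D₀.C
  -- a basis of `Ξ₀`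
  let bΞ := Module.finBasis Kbar D₀.Ξ
  set nΞ := finrank Kbar D₀.Ξ
  let ξv : Fin nΞ → δ → Kbar := fun e => (bΞ e : δ → Kbar)
  have ξv_mem : ∀ e, ξv e ∈ D₀.Ξ := fun e => (bΞ e).2
  have ξv_span : ∀ ξ ∈ D₀.Ξ, ξ ∈ Submodule.span Kbar (Set.range ξv) := by
    intro ξ hξ
    have e : ξ = ∑ e, (bΞ.repr ⟨ξ, hξ⟩ e) • ξv e := by
      have h := congrArg (fun x : D₀.Ξ => (x : δ → Kbar)) (bΞ.sum_repr ⟨ξ, hξ⟩)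
      simp only [Submodule.coe_sum, Submodule.coe_smul] at h
      exact h.symm
    rw [e]
    exact Submodule.sum_mem _ fun e _ => Submodule.smul_mem _ _ (Submodule.subset_span ⟨e, rfl⟩)
  have ξv_indep : LinearIndependent Kbar ξv :=
    bΞ.linearIndependent.map' D₀.Ξ.subtype (Submodule.ker_subtype _)
  -- the matrix `κ'`: `ξv e ∘ κ ∈ span_K C₀ = span_K {cv b}`
  have hspanC : Submodule.span Kbar ((fun c : γ → ℚ => fun k => (c k : Kbar)) '' (D₀.C : Set (γ → ℚ)))
      ≤ Submodule.span Kbar (Set.range fun b k => (cv b k : Kbar)) := by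
    rw [Submodule.span_le]
    rintro _ ⟨c, hc, rfl⟩
    have hc' := cv_span c hc
    rw [Submodule.mem_span_range_iff_exists_fun] at hc'
    obtain ⟨r, hr⟩ := hc'
    have e : (fun k => (c k : Kbar)) = ∑ b, (r b : Kbar) • fun k => (cv b k : Kbar) := by
      funext k
      have := congr_fun hr k
      simp only [Finset.sum_apply, Pi.smul_apply, smul_eq_mul] at this ⊢
      rw [← this]
      push_cast
      rfl
    show (fun k => (c k : Kbar)) ∈ _
    rw [e]
    exact Submodule.sum_mem _ fun b _ => Submodule.smul_mem _ _ (Submodule.subset_span ⟨b, rfl⟩)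
  have hκ : ∀ e, ∃ r : Fin nC → Kbar, (∑ b, r b • fun k => (cv b k : Kbar)) = fun k => ∑ e', ξv e e' * κM e' k := by
    intro e
    have := hspanC (D₀.compat (ξv e) (ξv_mem e))
    rwa [Submodule.mem_span_range_iff_exists_fun] at this
  choose κM' hκM' using hκ
  refine ⟨⟨nA, qv, qv_mem, qv_span, qv_unimod, nC, cv, cv_mem, cv_span, cv_unimod, nΞ, ξv,
    ξv_mem, ξv_span, ξv_indep, κM', fun e k => ?_⟩⟩
  have := congr_fun (hκM' e) k
  simp only [Finset.sum_apply, Pi.smul_apply, smul_eq_mul] at this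
  exact this.symm

namespace QuotData

variable {D₀ : SubgroupData β γ δ κM} (Q : QuotData D₀)

/-- The index type of the coordinates of `Lie(M_κ/K₀)`. [folklore] -/
abbrev σ' : Type := Fin Q.nA ⊕ (Fin Q.nC ⊕ Fin Q.nΞ)

/-- The quotient map `Φ : Lie M_κ → Lie(M_κ/K₀) = Lie M_κ'` in adapted coordinates. [folklore] -/
def Φ : (β ⊕ (γ ⊕ δ) → ℂ) →ₗ[ℂ] (Q.σ' → ℂ) where
  toFun w := Std.coords (fun j => ∑ i, (Q.qv j i : ℂ) * w (iy i))
    (fun b => ∑ k, (Q.cv b k : ℂ) * w (iz k))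
    (fun e => ∑ e', (Q.ξv e e' : ℂ) * w (is e'))
  map_add' v w := by
    funext x
    rcases x with j | b | e
    · simp only [Std.coords, Sum.elim_inl, Pi.add_apply, mul_add, Finset.sum_add_distrib]
    · simp only [Std.coords, Sum.elim_inr, Sum.elim_inl, Pi.add_apply, mul_add,
        Finset.sum_add_distrib]
    · simp only [Std.coords, Sum.elim_inr, Pi.add_apply, mul_add, Finset.sum_add_distrib]
  map_smul' c w := by
    funext x
    rcases x with j | b | e
    · simp only [Std.coords, Sum.elim_inl, Pi.smul_apply, smul_eq_mul, RingHom.id_apply,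
        Finset.mul_sum]
      exact Finset.sum_congr rfl fun i _ => by ring
    · simp only [Std.coords, Sum.elim_inr, Sum.elim_inl, Pi.smul_apply, smul_eq_mul,
        RingHom.id_apply, Finset.mul_sum]
      exact Finset.sum_congr rfl fun i _ => by ring
    · simp only [Std.coords, Sum.elim_inr, Pi.smul_apply, smul_eq_mul, RingHom.id_apply,
        Finset.mul_sum]
      exact Finset.sum_congr rfl fun i _ => by ring

/-- The `y'`-block of `Φ`. [folklore] -/
theorem Φ_iy (w) (j : Fin Q.nA) : Q.Φ w (Std.iy j) = ∑ i, (Q.qv j i : ℂ) * w (iy i) := rfl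
/-- The `z'`-block of `Φ`. [folklore] -/
theorem Φ_iz (w) (b : Fin Q.nC) : Q.Φ w (Std.iz b) = ∑ k, (Q.cv b k : ℂ) * w (iz k) := rfl
/-- The `s'`-block of `Φ`. [folklore] -/
theorem Φ_is (w) (e : Fin Q.nΞ) : Q.Φ w (Std.is e) = ∑ e', (Q.ξv e e' : ℂ) * w (is e') := rfl

/-- `ker Φ = Lie K₀`. [folklore] -/
theorem Φ_eq_zero_iff (w : β ⊕ (γ ⊕ δ) → ℂ) : Q.Φ w = 0 ↔ w ∈ D₀.tangent := by
  rw [SubgroupData.mem_tangent_iff]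
  constructor
  · intro h
    have hy : ∀ j, ∑ i, (Q.qv j i : ℂ) * w (iy i) = 0 := fun j => by
      have := congr_fun h (Std.iy j); rwa [Φ_iy] at this
    have hz : ∀ b, ∑ k, (Q.cv b k : ℂ) * w (iz k) = 0 := fun b => by
      have := congr_fun h (Std.iz b); rwa [Φ_iz] at this
    have hs : ∀ e, ∑ e', (Q.ξv e e' : ℂ) * w (is e') = 0 :=
      fun e => by have := congr_fun h (Std.is e); rwa [Φ_is] at this
    refine ⟨fun q hq => ?_, fun c hc => ?_, fun ξ hξ => ?_⟩
    · have hq' := Q.qv_span q hq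
      rw [Submodule.mem_span_range_iff_exists_fun] at hq'
      obtain ⟨r, rfl⟩ := hq'
      simp only [Finset.sum_apply, Pi.smul_apply, smul_eq_mul, Rat.cast_sum, Rat.cast_mul,
        Rat.cast_intCast, Finset.sum_mul]
      rw [Finset.sum_comm]
      refine Finset.sum_eq_zero fun j _ => ?_
      have := congrArg (fun x => (r j : ℂ) * x) (hy j)
      simpa [Finset.mul_sum, mul_assoc] using this
    · have hc' := Q.cv_span c hc
      rw [Submodule.mem_span_range_iff_exists_fun] at hc'
      obtain ⟨r, rfl⟩ := hc'
      simp only [Finset.sum_apply, Pi.smul_apply, smul_eq_mul, Rat.cast_sum, Rat.cast_mul,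
        Rat.cast_intCast, Finset.sum_mul]
      rw [Finset.sum_comm]
      refine Finset.sum_eq_zero fun b _ => ?_
      have := congrArg (fun x => (r b : ℂ) * x) (hz b)
      simpa [Finset.mul_sum, mul_assoc] using this
    · have hξ' := Q.ξv_span ξ hξ
      rw [Submodule.mem_span_range_iff_exists_fun] at hξ'
      obtain ⟨r, rfl⟩ := hξ'
      have : ∑ e, (r e : ℂ) * (∑ e', (Q.ξv e e' : ℂ) * w (is e')) = 0 :=
        Finset.sum_eq_zero fun e _ => by rw [hs e, mul_zero]
      rw [← this]
      simp only [Finset.sum_apply, Pi.smul_apply, smul_eq_mul]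
      push_cast
      simp only [Finset.sum_mul, Finset.mul_sum]
      rw [Finset.sum_comm]
      exact Finset.sum_congr rfl fun e _ => Finset.sum_congr rfl fun k _ => by ring
  · rintro ⟨hA, hC, hΞ⟩
    funext x
    rcases x with j | b | e
    · show Q.Φ w (Std.iy j) = 0
      rw [Φ_iy]
      simpa using hA _ (Q.qv_mem j)
    · show Q.Φ w (Std.iz b) = 0
      rw [Φ_iz]
      simpa using hC _ (Q.cv_mem b)
    · show Q.Φ w (Std.is e) = 0
      rw [Φ_is]
      exact hΞ _ (Q.ξv_mem e)

/-- `ker Φ = Lie K₀` as submodules. [folklore] -/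
theorem ker_Φ : LinearMap.ker Q.Φ = D₀.tangent := by
  ext w
  rw [LinearMap.mem_ker, Φ_eq_zero_iff]

/-- `Φ` is surjective. [folklore] -/
theorem Φ_surjective : Function.Surjective Q.Φ := by
  classical
  intro x
  choose py hpy using fun j => Q.qv_unimod (Pi.single j 1)
  choose pz hpz using fun b => Q.cv_unimod (Pi.single b 1)
  -- the `s`-block map is onto
  let Ψ : (δ → ℂ) →ₗ[ℂ] (Fin Q.nΞ → ℂ) :=
    { toFun := fun v e => ∑ s, (Q.ξv e s : ℂ) * v s
      map_add' := fun v v' => by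
        funext e; simp [mul_add, Finset.sum_add_distrib]
      map_smul' := fun c v => by
        funext e
        simp only [Pi.smul_apply, smul_eq_mul, RingHom.id_apply, Finset.mul_sum]
        exact Finset.sum_congr rfl fun s _ => by ring }
  have hΨs : ∀ s e, Ψ (Pi.single s 1) e = (Q.ξv e s : ℂ) := fun s e => by
    simp only [Ψ, LinearMap.coe_mk, AddHom.coe_mk]
    rw [Finset.sum_eq_single s (fun s' _ hs' => by simp [Pi.single_eq_of_ne hs'])
      (fun h => absurd (Finset.mem_univ s) h)]
    simp
  have hΨ : Function.Surjective Ψ := by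
    rw [← LinearMap.range_eq_top]
    by_contra hne
    obtain ⟨f, hf0, hle⟩ := Submodule.exists_le_ker_of_lt_top _ (lt_top_iff_ne_top.mpr hne)
    apply hf0
    let c : Fin Q.nΞ → ℂ := fun e => f (Pi.single e 1)
    have hf : ∀ u : Fin Q.nΞ → ℂ, f u = ∑ e, c e * u e := by
      intro u
      conv_lhs => rw [pi_eq_sum_univ u]
      simp only [map_sum, map_smul, smul_eq_mul, c]
      refine Finset.sum_congr rfl fun e _ => ?_
      rw [mul_comm]
      congr 2
      funext e'
      simp [Pi.single_apply, eq_comm]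
    have hrel : ∑ e, c e • (fun s => (Q.ξv e s : ℂ)) = 0 := by
      funext s
      have hmem : Ψ (Pi.single s 1) ∈ LinearMap.range Ψ := LinearMap.mem_range_self _ _
      have := hle hmem
      rw [LinearMap.mem_ker, hf] at this
      simp only [Finset.sum_apply, Pi.smul_apply, smul_eq_mul, Pi.zero_apply]
      rw [← this]
      exact Finset.sum_congr rfl fun e _ => by rw [hΨs]
    have hind := linearIndependent_ofK (L := ℂ) Q.ξv_indep
    have hc0 : ∀ e, c e = 0 := by
      have := Fintype.linearIndependent_iff.mp hind c (by
        rw [← hrel]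
        refine Finset.sum_congr rfl fun e _ => ?_
        rfl)
      exact this
    refine LinearMap.ext fun u => ?_
    rw [hf]
    simp [hc0]
  obtain ⟨v, hv⟩ := hΨ fun e => x (Std.is e)
  refine ⟨Std.coords (fun i => ∑ j, x (Std.iy j) * (py j i : ℂ))
    (fun k => ∑ b, x (Std.iz b) * (pz b k : ℂ)) v, ?_⟩
  funext s
  rcases s with j | b | e
  · show Q.Φ _ (Std.iy j) = x (Std.iy j)
    rw [Φ_iy]
    simp only [coords_iy]
    have key : ∀ j', ∑ i, (Q.qv j i : ℂ) * (py j' i : ℂ) = if j = j' then 1 else 0 := by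
      intro j'
      have := hpy j' j
      have h := congrArg (fun n : ℤ => (n : ℂ)) this
      push_cast at h
      rw [h, Pi.single_apply]
      split_ifs <;> simp
    calc ∑ i, (Q.qv j i : ℂ) * ∑ j', x (Std.iy j') * (py j' i : ℂ)
        = ∑ j', x (Std.iy j') * ∑ i, (Q.qv j i : ℂ) * (py j' i : ℂ) := by
          simp only [Finset.mul_sum]
          rw [Finset.sum_comm]
          exact Finset.sum_congr rfl fun j' _ => Finset.sum_congr rfl fun i _ => by ring
      _ = x (Std.iy j) := by
          simp only [key, mul_ite, mul_one, mul_zero, Finset.sum_ite_eq, Finset.mem_univ, if_true]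
  · show Q.Φ _ (Std.iz b) = x (Std.iz b)
    rw [Φ_iz]
    simp only [coords_iz]
    have key : ∀ b', ∑ k, (Q.cv b k : ℂ) * (pz b' k : ℂ) = if b = b' then 1 else 0 := by
      intro b'
      have := hpz b' b
      have h := congrArg (fun n : ℤ => (n : ℂ)) this
      push_cast at h
      rw [h, Pi.single_apply]
      split_ifs <;> simp
    calc ∑ k, (Q.cv b k : ℂ) * ∑ b', x (Std.iz b') * (pz b' k : ℂ)
        = ∑ b', x (Std.iz b') * ∑ k, (Q.cv b k : ℂ) * (pz b' k : ℂ) := by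
          simp only [Finset.mul_sum]
          rw [Finset.sum_comm]
          exact Finset.sum_congr rfl fun b' _ => Finset.sum_congr rfl fun k _ => by ring
      _ = x (Std.iz b) := by
          simp only [key, mul_ite, mul_one, mul_zero, Finset.sum_ite_eq, Finset.mem_univ, if_true]
  · have := congr_fun hv e
    simp only [Ψ, LinearMap.coe_mk, AddHom.coe_mk] at this
    show Q.Φ _ (Std.is e) = x (Std.is e)
    rw [Φ_is]
    simp only [coords_is]
    exact this

/-- Dimension of preimages: `dim Φ⁻¹(X) = dim X + dim Lie K₀`. [folklore] -/
theorem finrank_comap (X : Submodule ℂ (Q.σ' → ℂ)) :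
    finrank ℂ ↥(X.comap Q.Φ) = finrank ℂ X + finrank ℂ ↥D₀.tangent := by
  let Φ' := Q.Φ.domRestrict (X.comap Q.Φ)
  have hrange : LinearMap.range Φ' = X := by
    apply le_antisymm
    · rintro _ ⟨⟨w, hw⟩, rfl⟩
      exact hw
    · intro x hx
      obtain ⟨w, rfl⟩ := Q.Φ_surjective x
      exact ⟨⟨w, hx⟩, rfl⟩
  have hker : finrank ℂ ↥(LinearMap.ker Φ') = finrank ℂ ↥D₀.tangent := by
    rw [LinearMap.ker_domRestrict, Q.ker_Φ]
    have hle : D₀.tangent ≤ X.comap Q.Φ := by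
      intro w hw
      rw [Submodule.mem_comap, (Q.Φ_eq_zero_iff w).mpr hw]
      exact X.zero_mem
    exact (Submodule.comapSubtypeEquivOfLe hle).finrank_eq
  have := LinearMap.finrank_range_add_finrank_ker Φ'
  rw [hrange, hker] at this
  exact this.symm

/-- `dim M_κ = dim M_κ' + dim K₀`. [folklore] -/
theorem card_eq : Fintype.card (β ⊕ (γ ⊕ δ)) = Fintype.card Q.σ' + finrank ℂ ↥D₀.tangent := by
  have e1 : finrank ℂ ↥((⊤ : Submodule ℂ (Q.σ' → ℂ)).comap Q.Φ) =
      finrank ℂ (⊤ : Submodule ℂ (Q.σ' → ℂ)) + finrank ℂ ↥D₀.tangent := Q.finrank_comap ⊤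
  rw [Submodule.comap_top, finrank_top, finrank_top, Module.finrank_fintype_fun_eq_card,
    Module.finrank_fintype_fun_eq_card] at e1
  exact e1

/-- `Φ⁻¹(Φ(𝔟)) = 𝔟 + Lie K₀`. [folklore] -/
theorem comap_map (𝔟 : Submodule ℂ ((β ⊕ (γ ⊕ δ)) → ℂ)) : (𝔟.map Q.Φ).comap Q.Φ = 𝔟 ⊔ D₀.tangent := by
  rw [Submodule.comap_map_eq, Q.ker_Φ]

/-- The same map over `K = ℚ̄`. [folklore] -/
def ΦK (w : β ⊕ (γ ⊕ δ) → Kbar) : Q.σ' → Kbar :=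
  Std.coords (fun j => ∑ i, (Q.qv j i : Kbar) * w (iy i))
    (fun b => ∑ k, (Q.cv b k : Kbar) * w (iz k))
    (fun e => ∑ e', Q.ξv e e' * w (is e'))

/-- `Φ` is defined over `K`. [folklore] -/
theorem Φ_ofK (w : β ⊕ (γ ⊕ δ) → Kbar) :
    Q.Φ (LiePresentation.ofK Kbar w) = LiePresentation.ofK Kbar (Q.ΦK w) := by
  funext s
  rcases s with j | b | e
  · show ∑ i, (Q.qv j i : ℂ) * algebraMap Kbar ℂ (w (iy i)) =
      algebraMap Kbar ℂ (∑ i, (Q.qv j i : Kbar) * w (iy i))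
    rw [map_sum]
    exact Finset.sum_congr rfl fun i _ => by rw [map_mul, map_intCast]
  · show ∑ k, (Q.cv b k : ℂ) * algebraMap Kbar ℂ (w (iz k)) =
      algebraMap Kbar ℂ (∑ k, (Q.cv b k : Kbar) * w (iz k))
    rw [map_sum]
    exact Finset.sum_congr rfl fun k _ => by rw [map_mul, map_intCast]
  · show ∑ e', (Q.ξv e e' : ℂ) * algebraMap Kbar ℂ (w (is e')) =
      algebraMap Kbar ℂ (∑ e', Q.ξv e e' * w (is e'))
    rw [map_sum]
    exact Finset.sum_congr rfl fun e' _ => by rw [map_mul]; rfl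

/-- Images of `K`-rational subspaces are `K`-rational. [folklore] -/
theorem isKRational_map {𝔟 : Submodule ℂ ((β ⊕ (γ ⊕ δ)) → ℂ)}
    (h : LiePresentation.IsKRational Kbar 𝔟) : LiePresentation.IsKRational Kbar (𝔟.map Q.Φ) := by
  obtain ⟨S, rfl⟩ := h
  refine ⟨Q.ΦK '' S, ?_⟩
  rw [Submodule.map_span, Set.image_image, Set.image_image]
  congr 1
  exact Set.image_congr fun w _ => Q.Φ_ofK w

/-! #### Pull-back of subgroups of `M_κ/K₀` to subgroups of `M_κ` containing `K₀` -/

/-- The `ℚ`-linear map `q' ↦ ∑_j q'_j q⁽ʲ⁾`. [folklore] -/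
def qLin : (Fin Q.nA → ℚ) →ₗ[ℚ] (β → ℚ) where
  toFun q' := fun i => ∑ j, q' j * (Q.qv j i : ℚ)
  map_add' a b := by funext i; simp [add_mul, Finset.sum_add_distrib]
  map_smul' c a := by funext i; simp [Finset.mul_sum, mul_assoc]

/-- The `ℚ`-linear map `c' ↦ ∑_b c'_b c⁽ᵇ⁾`. [folklore] -/
def cLin : (Fin Q.nC → ℚ) →ₗ[ℚ] (γ → ℚ) where
  toFun c' := fun k => ∑ b, c' b * (Q.cv b k : ℚ)
  map_add' a b := by funext i; simp [add_mul, Finset.sum_add_distrib]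
  map_smul' c a := by funext i; simp [Finset.mul_sum, mul_assoc]

/-- The `K`-linear map `ξ' ↦ ∑_e ξ'_e ξ⁽ᵉ⁾`. [folklore] -/
def ξLin : (Fin Q.nΞ → Kbar) →ₗ[Kbar] (δ → Kbar) where
  toFun ξ' := ∑ e, ξ' e • Q.ξv e
  map_add' a b := by simp [add_smul, Finset.sum_add_distrib]
  map_smul' c a := by simp [Finset.smul_sum, smul_smul]

/-- The connected algebraic subgroup `K ⊇ K₀` of `M_κ` corresponding to a connected algebraic
subgroup `K/K₀` of `M_κ/K₀ = M_κ'`. [folklore] -/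
def pull (D' : SubgroupData (Fin Q.nA) (Fin Q.nC) (Fin Q.nΞ) Q.κM') : SubgroupData β γ δ κM where
  A := D'.A.map Q.qLin
  C := D'.C.map Q.cLin
  Ξ := D'.Ξ.map Q.ξLin
  compat := by
    classical
    rintro _ ⟨ξ', hξ', rfl⟩
    have hc := D'.compat ξ' hξ'
    -- `(ξLin ξ') ∘ κ = ∑_b (ξ' κ')_b • c⁽ᵇ⁾`
    have ht : (fun k => ∑ e', Q.ξLin ξ' e' * κM e' k) =
        ∑ b, (∑ e, ξ' e * Q.κM' e b) • fun k => (Q.cv b k : Kbar) := by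
      funext k
      have lhs : ∑ e', Q.ξLin ξ' e' * κM e' k = ∑ e, ξ' e * ∑ e', Q.ξv e e' * κM e' k := by
        simp only [ξLin, LinearMap.coe_mk, AddHom.coe_mk, Finset.sum_apply, Pi.smul_apply,
          smul_eq_mul, Finset.sum_mul, Finset.mul_sum]
        rw [Finset.sum_comm]
        exact Finset.sum_congr rfl fun e _ => Finset.sum_congr rfl fun e' _ => by ring
      have rhs : (∑ b, (∑ e, ξ' e * Q.κM' e b) • fun k => (Q.cv b k : Kbar)) k =
          ∑ e, ξ' e * ∑ b, Q.κM' e b * (Q.cv b k : Kbar) := by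
        simp only [Finset.sum_apply, Pi.smul_apply, smul_eq_mul, Finset.sum_mul, Finset.mul_sum]
        rw [Finset.sum_comm]
        exact Finset.sum_congr rfl fun e _ => Finset.sum_congr rfl fun b _ => by ring
      rw [lhs, rhs]
      exact Finset.sum_congr rfl fun e _ => by rw [Q.κM'_spec]
    rw [ht]
    have key : ∀ lam ∈ Submodule.span Kbar
        ((fun c : Fin Q.nC → ℚ => fun b => (c b : Kbar)) '' (D'.C : Set (Fin Q.nC → ℚ))),
        (∑ b, lam b • fun k => (Q.cv b k : Kbar)) ∈ Submodule.span Kbar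
          ((fun c : γ → ℚ => fun k => (c k : Kbar)) '' ((D'.C.map Q.cLin : Submodule ℚ (γ → ℚ)) :
            Set (γ → ℚ))) := by
      intro lam hlam
      induction hlam using Submodule.span_induction with
      | mem x hx =>
        obtain ⟨c', hc', rfl⟩ := hx
        refine Submodule.subset_span ⟨Q.cLin c', ⟨c', hc', rfl⟩, ?_⟩
        funext k
        simp [cLin, Finset.sum_apply, Pi.smul_apply]
      | zero => simp
      | add x y _ _ hx hy =>
        simp only [Pi.add_apply, add_smul, Finset.sum_add_distrib]
        exact Submodule.add_mem _ hx hy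
      | smul r x _ hx =>
        simp only [Pi.smul_apply, smul_eq_mul, ← smul_smul, ← Finset.smul_sum]
        exact Submodule.smul_mem _ _ hx
    exact key _ hc

/-- `Φ⁻¹(Lie(K/K₀)) = Lie K`. [folklore] -/
theorem comap_tangent (D' : SubgroupData (Fin Q.nA) (Fin Q.nC) (Fin Q.nΞ) Q.κM') :
    D'.tangent.comap Q.Φ = (Q.pull D').tangent := by
  ext w
  rw [Submodule.mem_comap, SubgroupData.mem_tangent_iff, SubgroupData.mem_tangent_iff]
  simp only [pull, Submodule.mem_map]
  constructor
  · rintro ⟨hA, hC, hΞ⟩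
    refine ⟨?_, ?_, ?_⟩
    · rintro _ ⟨q', hq', rfl⟩
      have := hA q' hq'
      simp only [Φ_iy] at this
      simp only [qLin, LinearMap.coe_mk, AddHom.coe_mk, Rat.cast_sum, Rat.cast_mul,
        Rat.cast_intCast, Finset.sum_mul]
      rw [Finset.sum_comm, ← this]
      simp only [Finset.mul_sum]
      exact Finset.sum_congr rfl fun j _ => Finset.sum_congr rfl fun i _ => by ring
    · rintro _ ⟨c', hc', rfl⟩
      have := hC c' hc'
      simp only [Φ_iz] at this
      simp only [cLin, LinearMap.coe_mk, AddHom.coe_mk, Rat.cast_sum, Rat.cast_mul,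
        Rat.cast_intCast, Finset.sum_mul]
      rw [Finset.sum_comm, ← this]
      simp only [Finset.mul_sum]
      exact Finset.sum_congr rfl fun b _ => Finset.sum_congr rfl fun k _ => by ring
    · rintro _ ⟨ξ', hξ', rfl⟩
      have := hΞ ξ' hξ'
      simp only [Φ_is] at this
      rw [← this]
      simp only [ξLin, LinearMap.coe_mk, AddHom.coe_mk, Finset.sum_apply, Pi.smul_apply,
        smul_eq_mul]
      push_cast
      simp only [Finset.sum_mul, Finset.mul_sum]
      rw [Finset.sum_comm]
      exact Finset.sum_congr rfl fun e _ => Finset.sum_congr rfl fun k _ => by ring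
  · rintro ⟨hA, hC, hΞ⟩
    refine ⟨fun q' hq' => ?_, fun c' hc' => ?_, fun ξ' hξ' => ?_⟩
    · have := hA _ ⟨q', hq', rfl⟩
      simp only [qLin, LinearMap.coe_mk, AddHom.coe_mk, Rat.cast_sum, Rat.cast_mul,
        Rat.cast_intCast, Finset.sum_mul] at this
      rw [Finset.sum_comm] at this
      simp only [Φ_iy, Finset.mul_sum]
      rw [← this]
      exact Finset.sum_congr rfl fun j _ => Finset.sum_congr rfl fun i _ => by ring
    · have := hC _ ⟨c', hc', rfl⟩
      simp only [cLin, LinearMap.coe_mk, AddHom.coe_mk, Rat.cast_sum, Rat.cast_mul,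
        Rat.cast_intCast, Finset.sum_mul] at this
      rw [Finset.sum_comm] at this
      simp only [Φ_iz, Finset.mul_sum]
      rw [← this]
      exact Finset.sum_congr rfl fun b _ => Finset.sum_congr rfl fun k _ => by ring
    · have := hΞ _ ⟨ξ', hξ', rfl⟩
      rw [← this]
      simp only [Φ_is, ξLin, LinearMap.coe_mk, AddHom.coe_mk, Finset.sum_apply, Pi.smul_apply,
        smul_eq_mul]
      push_cast
      simp only [Finset.sum_mul, Finset.mul_sum]
      rw [Finset.sum_comm]
      exact Finset.sum_congr rfl fun e _ => Finset.sum_congr rfl fun k _ => by ring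

/-- `Lie K₀ ⊆ Lie K`. [folklore] -/
theorem tangent_le_pull (D' : SubgroupData (Fin Q.nA) (Fin Q.nC) (Fin Q.nΞ) Q.κM') :
    D₀.tangent ≤ (Q.pull D').tangent := by
  intro w hw
  rw [← comap_tangent, Submodule.mem_comap, (Q.Φ_eq_zero_iff w).mpr hw]
  exact Submodule.zero_mem _

/-- `K ≠ M_κ` if `K/K₀ ≠ M_κ/K₀`. [folklore] -/
theorem pull_ne_top {D' : SubgroupData (Fin Q.nA) (Fin Q.nC) (Fin Q.nΞ) Q.κM'}
    (h : D'.tangent ≠ ⊤) : (Q.pull D').tangent ≠ ⊤ := by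
  intro htop
  apply h
  rw [eq_top_iff]
  intro x _
  obtain ⟨w, rfl⟩ := Q.Φ_surjective x
  have : w ∈ (Q.pull D').tangent := by rw [htop]; exact Submodule.mem_top
  rw [← comap_tangent, Submodule.mem_comap] at this
  exact this

/-! #### Algebraic points and the kernel under `Φ` -/

/-- `Φ` maps `AlgTors(M_κ)` into `AlgTors(M_κ')`. [folklore] -/
theorem Φ_mem_AlgTors {L : PeriodPair} (h₂ : IsAlgebraic ℚ L.g₂) (h₃ : IsAlgebraic ℚ L.g₃)
    {w : β ⊕ (γ ⊕ δ) → ℂ} (hw : w ∈ AlgTors L κM) : Q.Φ w ∈ AlgTors L Q.κM' := by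
  obtain ⟨⟨hy, t, hzt, hs⟩, htor⟩ := hw
  refine ⟨⟨fun j => ?_, fun b => ∑ k, (Q.cv b k : ℂ) * t k, fun b => ?_, fun e => ?_⟩, fun b => ?_⟩
  · rw [Φ_iy, Complex.exp_sum]
    refine Finset.prod_induction _ (fun x => IsAlgebraic ℚ x) (fun a b ha hb => ha.mul hb)
      isAlgebraic_one fun i _ => ?_
    rw [Complex.exp_int_mul]
    exact isAlgebraic_zpow (hy i) _
  · rw [Φ_iz]
    exact PeriodPair.IsUnivExtAlgPoint.sum_int_mul h₂ h₃ _ _ _ _ fun k _ => hzt k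
  · rw [Φ_is]
    have hκ : ∀ k, (∑ e', (Q.ξv e e' : ℂ) * (κM e' k : ℂ)) = ∑ b, (Q.κM' e b : ℂ) * (Q.cv b k : ℂ) := by
      intro k
      have := congrArg (algebraMap Kbar ℂ) (Q.κM'_spec e k)
      simpa [map_sum, map_mul] using this
    have e1 : ∑ e', (Q.ξv e e' : ℂ) * w (is e') - ∑ b, (Q.κM' e b : ℂ) * ∑ k, (Q.cv b k : ℂ) * t k =
        ∑ e', (Q.ξv e e' : ℂ) * (w (is e') - ∑ k, (κM e' k : ℂ) * t k) := by
      have e2 : ∑ b, (Q.κM' e b : ℂ) * ∑ k, (Q.cv b k : ℂ) * t k =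
          ∑ k, (∑ b, (Q.κM' e b : ℂ) * (Q.cv b k : ℂ)) * t k := by
        simp only [Finset.mul_sum, Finset.sum_mul]
        rw [Finset.sum_comm]
        exact Finset.sum_congr rfl fun k _ => Finset.sum_congr rfl fun b _ => by ring
      have e3 : ∑ e', (Q.ξv e e' : ℂ) * (w (is e') - ∑ k, (κM e' k : ℂ) * t k) =
          ∑ e', (Q.ξv e e' : ℂ) * w (is e') - ∑ k, (∑ e', (Q.ξv e e' : ℂ) * (κM e' k : ℂ)) * t k := by
        simp only [mul_sub, Finset.sum_sub_distrib, Finset.mul_sum, Finset.sum_mul]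
        congr 1
        rw [Finset.sum_comm]
        exact Finset.sum_congr rfl fun k _ => Finset.sum_congr rfl fun e' _ => by ring
      rw [e2, e3]
      simp only [hκ]
    rw [e1]
    refine Finset.sum_induction _ (fun x => IsAlgebraic ℚ x) (fun a b ha hb => ha.add hb)
      isAlgebraic_zero fun e' _ => ?_
    exact (isAlgebraic_coe_Kbar (Q.ξv e e')).mul (hs e')
  · rw [Φ_iz]
    exact PeriodPair.IsTorsionPt.sum_int_mul _ _ _ fun k _ => htor k

/-- **Lifting the kernel** (unimodularity): if `Φ w ∈ ker(exp_{M_κ'})` then `w ∈ ker(exp_{M_κ}) + Lie K₀`.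
[folklore] -/
theorem exists_ker_of_Φ_mem_ker {L : PeriodPair} {w : β ⊕ (γ ⊕ δ) → ℂ}
    (hw : Q.Φ w ∈ ker L Q.κM') : ∃ k ∈ ker L κM, w - k ∈ D₀.tangent := by
  obtain ⟨hy, m', n', hz, hs⟩ := hw
  choose p' hp' using hy
  obtain ⟨p, hp⟩ := Q.qv_unimod p'
  obtain ⟨m, hm⟩ := Q.cv_unimod m'
  obtain ⟨n, hn⟩ := Q.cv_unimod n'
  refine ⟨Std.coords (fun i => (p i : ℂ) * (2 * Real.pi * I))
    (fun k => (m k : ℂ) * L.ω₁ + (n k : ℂ) * L.ω₂)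
    (fun e' => ∑ k, (κM e' k : ℂ) * ((m k : ℂ) * L.η₁ + (n k : ℂ) * L.η₂)),
    ⟨fun i => ⟨p i, rfl⟩, m, n, fun k => rfl, fun e' => rfl⟩, ?_⟩
  rw [← Q.Φ_eq_zero_iff, map_sub, sub_eq_zero]
  funext s
  rcases s with j | b | e
  · show Q.Φ w (Std.iy j) = Q.Φ _ (Std.iy j)
    rw [hp' j, Φ_iy]
    simp only [coords_iy]
    have := congrArg (fun x : ℤ => (x : ℂ)) (hp j)
    push_cast at this
    rw [← this, Finset.sum_mul]
    exact Finset.sum_congr rfl fun i _ => by ring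
  · show Q.Φ w (Std.iz b) = Q.Φ _ (Std.iz b)
    rw [hz b, Φ_iz]
    simp only [coords_iz]
    have h1 := congrArg (fun x : ℤ => (x : ℂ)) (hm b)
    have h2 := congrArg (fun x : ℤ => (x : ℂ)) (hn b)
    push_cast at h1 h2
    rw [← h1, ← h2, Finset.sum_mul, Finset.sum_mul, ← Finset.sum_add_distrib]
    exact Finset.sum_congr rfl fun k _ => by ring
  · show Q.Φ w (Std.is e) = Q.Φ _ (Std.is e)
    rw [hs e, Φ_is]
    simp only [coords_is]
    have hκ : ∀ k, (∑ e', (Q.ξv e e' : ℂ) * (κM e' k : ℂ)) = ∑ b, (Q.κM' e b : ℂ) * (Q.cv b k : ℂ) := by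
      intro k
      have := congrArg (algebraMap Kbar ℂ) (Q.κM'_spec e k)
      simpa [map_sum, map_mul] using this
    have h1 : ∀ b, (m' b : ℂ) = ∑ k, (Q.cv b k : ℂ) * (m k : ℂ) := fun b => by
      have := congrArg (fun x : ℤ => (x : ℂ)) (hm b); push_cast at this; exact this.symm
    have h2 : ∀ b, (n' b : ℂ) = ∑ k, (Q.cv b k : ℂ) * (n k : ℂ) := fun b => by
      have := congrArg (fun x : ℤ => (x : ℂ)) (hn b); push_cast at this; exact this.symm
    -- both sides equal `∑_k (∑_e' ξv e e' κ e' k) (m_k η₁ + n_k η₂)`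
    have lhs : ∑ b, (Q.κM' e b : ℂ) * (m' b * L.η₁ + n' b * L.η₂) =
        ∑ k, (∑ b, (Q.κM' e b : ℂ) * (Q.cv b k : ℂ)) * ((m k : ℂ) * L.η₁ + (n k : ℂ) * L.η₂) := by
      simp only [h1, h2, Finset.sum_mul, Finset.mul_sum, mul_add, Finset.sum_add_distrib]
      congr 1
      · rw [Finset.sum_comm]
        exact Finset.sum_congr rfl fun b _ => Finset.sum_congr rfl fun k _ => by ring
      · rw [Finset.sum_comm]
        exact Finset.sum_congr rfl fun b _ => Finset.sum_congr rfl fun k _ => by ring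
    have rhs : ∑ e', (Q.ξv e e' : ℂ) * ∑ k, (κM e' k : ℂ) * ((m k : ℂ) * L.η₁ + (n k : ℂ) * L.η₂) =
        ∑ k, (∑ e', (Q.ξv e e' : ℂ) * (κM e' k : ℂ)) * ((m k : ℂ) * L.η₁ + (n k : ℂ) * L.η₂) := by
      simp only [Finset.mul_sum, Finset.sum_mul]
      rw [Finset.sum_comm]
      exact Finset.sum_congr rfl fun k _ => Finset.sum_congr rfl fun e' _ => by ring
    rw [lhs, rhs]
    simp only [hκ]

/-! ### The transport theorem -/

/-- **Transport to the quotient by a borderline subgroup.** Let `𝔟 ⊊ Lie M_κ` be `ℚ̄`-rational and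
semistable, and `K₀ ≠ M_κ` a connected algebraic subgroup (`ℚ̄`-data) which is BORDERLINE for `𝔟`:
`dim 𝔟·(n - dim 𝔨₀) = (dim 𝔟 - dim(𝔟 ∩ 𝔨₀))·n`. Then the image `Φ(𝔟) ⊆ Lie(M_κ/K₀) = Lie M_κ'`
is `ℚ̄`-rational, proper, and semistable in `M_κ'`.
[cite: BakerWustholz2007, §6.7 (index), §6.8 (p. 115: "Clearly π_* 𝔟 is semistable")] -/
theorem transport {𝔟 : Submodule ℂ (β ⊕ (γ ⊕ δ) → ℂ)} (hrat : IsKRational Kbar 𝔟) (h𝔟 : 𝔟 ≠ ⊤)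
    (hss : Semistable κM 𝔟) (hD₀ : D₀.tangent ≠ ⊤)
    (hbord : finrank ℂ 𝔟 * (Fintype.card (β ⊕ (γ ⊕ δ)) - finrank ℂ D₀.tangent) =
      (finrank ℂ 𝔟 - finrank ℂ ↥(𝔟 ⊓ D₀.tangent)) * Fintype.card (β ⊕ (γ ⊕ δ))) :
    IsKRational Kbar (𝔟.map Q.Φ) ∧ 𝔟.map Q.Φ ≠ ⊤ ∧ Semistable Q.κM' (𝔟.map Q.Φ) := by
  set n := Fintype.card (β ⊕ (γ ⊕ δ)) with hn
  set d := finrank ℂ 𝔟 with hd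
  set k := finrank ℂ D₀.tangent with hk
  set i₀ := finrank ℂ ↥(𝔟 ⊓ D₀.tangent) with hi₀
  set 𝔟' : Submodule ℂ (Q.σ' → ℂ) := 𝔟.map Q.Φ with h𝔟'
  have hcard : n = Fintype.card Q.σ' + k := Q.card_eq
  have hcomap : 𝔟'.comap Q.Φ = 𝔟 ⊔ D₀.tangent := Q.comap_map 𝔟
  -- dimensions
  have hsup : finrank ℂ ↥(𝔟 ⊔ D₀.tangent) + i₀ = d + k := Submodule.finrank_sup_add_finrank_inf_eq 𝔟 D₀.tangent
  have hdim𝔟' : finrank ℂ 𝔟' + k = finrank ℂ ↥(𝔟 ⊔ D₀.tangent) := by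
    rw [← hcomap]; exact (Q.finrank_comap 𝔟').symm
  have hdlt : d < n := by
    have := Submodule.finrank_lt h𝔟; simpa [hn, hd] using this
  have hklt : k < n := by
    have := Submodule.finrank_lt hD₀; simpa [hn, hk] using this
  have hi₀d : i₀ ≤ d := Submodule.finrank_mono inf_le_left
  have hi₀k : i₀ ≤ k := Submodule.finrank_mono inf_le_right
  have hsuple : finrank ℂ ↥(𝔟 ⊔ D₀.tangent) ≤ n := by
    have := Submodule.finrank_le (𝔟 ⊔ D₀.tangent); simpa [hn] using this
  -- (T1) rationality
  have h1 : IsKRational Kbar 𝔟' := Q.isKRational_map hrat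
  -- (T2) properness: `𝔟 + 𝔨₀ = Lie M_κ` would contradict the borderline equality
  have h2 : 𝔟' ≠ ⊤ := by
    intro htop
    have hfull : finrank ℂ ↥(𝔟 ⊔ D₀.tangent) = n := by
      rw [← hcomap, htop, Submodule.comap_top, finrank_top, Module.finrank_fintype_fun_eq_card]
    -- `d + k - i₀ = n`, borderline: `d(n-k) = (d-i₀)n` ⇒ `(n-k)(n-d) = 0`
    rw [hfull] at hsup
    have e1 : (d - i₀) * n = (n - k) * n := by
      congr 1; omega
    rw [e1] at hbord
    -- `d (n - k) = (n - k) n` with `d < n` forces `n - k = 0`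
    have : (n - k) * d = (n - k) * n := by rw [mul_comm (n - k) d]; exact hbord
    have hnk : n - k = 0 := by
      by_contra hne
      have hpos : 0 < n - k := Nat.pos_of_ne_zero hne
      have := Nat.eq_of_mul_eq_mul_left hpos this
      omega
    omega
  -- (T3) semistability
  have h3 : Semistable Q.κM' 𝔟' := by
    rintro _ ⟨D', rfl⟩ h𝔨'top
    set P := (Q.pull D').tangent with hP
    have hPtop : P ≠ ⊤ := Q.pull_ne_top h𝔨'top
    have h𝔨₀P : D₀.tangent ≤ P := Q.tangent_le_pull D'
    have hssP := hss P ⟨Q.pull D', rfl⟩ hPtop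
    -- dimensions of `P` and `𝔟 ⊓ P` versus the quotient data
    set kP := finrank ℂ P with hkP
    set iP := finrank ℂ ↥(𝔟 ⊓ P) with hiP
    have hdimK : kP = finrank ℂ ↥D'.tangent + k := by
      rw [hkP, hP, ← Q.comap_tangent]; exact Q.finrank_comap _
    have hmod : (𝔟 ⊔ D₀.tangent) ⊓ P = (𝔟 ⊓ P) ⊔ D₀.tangent := by
      rw [sup_comm 𝔟 D₀.tangent, sup_comm (𝔟 ⊓ P) D₀.tangent]
      exact sup_inf_assoc_of_le 𝔟 h𝔨₀P
    have hinf2 : (𝔟 ⊓ P) ⊓ D₀.tangent = 𝔟 ⊓ D₀.tangent := by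
      rw [inf_assoc, inf_eq_right.mpr h𝔨₀P]
    have hsup2 : finrank ℂ ↥((𝔟 ⊓ P) ⊔ D₀.tangent) + i₀ = iP + k := by
      have := Submodule.finrank_sup_add_finrank_inf_eq (𝔟 ⊓ P) D₀.tangent
      rwa [hinf2] at this
    have hdimI : finrank ℂ ↥(𝔟' ⊓ D'.tangent) + k = finrank ℂ ↥((𝔟 ⊓ P) ⊔ D₀.tangent) := by
      rw [← hmod, ← hcomap, hP, ← Q.comap_tangent, ← Submodule.comap_inf]
      exact (Q.finrank_comap _).symm
    -- abbreviations
    set d' := finrank ℂ 𝔟' with hd'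
    set k' := finrank ℂ ↥D'.tangent with hk'
    set i' := finrank ℂ ↥(𝔟' ⊓ D'.tangent) with hi'
    set n' := Fintype.card Q.σ' with hn'
    -- the identities: `d' = d - i₀`, `i' = iP - i₀`, `kP = k' + k`, `n = n' + k`
    have hd'eq : d' + i₀ = d := by omega
    have hi'eq : i' + i₀ = iP := by omega
    have hiPd : iP ≤ d := Submodule.finrank_mono inf_le_left
    have hkPn : kP ≤ n := by have := Submodule.finrank_le P; simpa [hn] using this
    -- semistability at `P`: `d (n - kP) ≤ (d - iP) n`; borderline: `d (n - k) = (d - i₀) n`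
    change d * (n - kP) ≤ (d - iP) * n at hssP
    -- goal: `d' (n' - k') ≤ (d' - i') n'`
    show d' * (n' - k') ≤ (d' - i') * n'
    -- multiply by `n > 0` and compare
    have hnpos : 0 < n := by omega
    have key : n * (d' * (n' - k')) ≤ n * ((d' - i') * n') := by
      have e1 : n * (d' * (n' - k')) = ((d - i₀) * n) * (n - kP) := by
        have : n' - k' = n - kP := by omega
        rw [this, show d' = d - i₀ by omega]; ring
      have e2 : n * ((d' - i') * n') = (n - k) * ((d - iP) * n) := by
        have : d' - i' = d - iP := by omega
        rw [this, show n' = n - k by omega]; ring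
      rw [e1, e2, ← hbord]
      calc d * (n - k) * (n - kP) = (n - k) * (d * (n - kP)) := by ring
        _ ≤ (n - k) * ((d - iP) * n) := Nat.mul_le_mul_left _ hssP
    exact Nat.le_of_mul_le_mul_left key hnpos
  exact ⟨h1, h2, h3⟩

end QuotData

end Std

end GaGmE

end Literature.NumberTheory.Transcendental

end
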